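import Mathlib

/-!
# Route `FordMaynardSieveConst01651`, target `SieveConst01651` (stmt-Parity-19185), line `sieve_decomposition`:
# helpers towards `stub_typeIIRegion` — regrouping a sum over `N`-tuples along a set of coordinates `E`

Ford–Maynard, arXiv:2407.14368v1, proof of Proposition 7.22, last step (p. 43): "Let
`Y₁(n') := ∑_{n' = ∏_{e∈E} n_e} ∏_{e∈E} υ_e(n_e)`, `Y₂(n'') := ∑_{n'' = ∏_{e∉E} n_e} ∏_{e∉E} υ_e(n_e)`. Thus, the
left side of (eq:sieve-final) equals `∑_{n = n'n'' ∼ x, n' ∈ ((x/2)^θ, x^{θ+ν}]} Y₁(n') Y₂(n'') w_{n'n''}`."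
The combinatorial content is the bijection
`{t : [N] → ℕ, ∏ t = n} ≃ ⨆_{n' n'' = n} {a : E → ℕ, ∏ a = n'} × {b : Eᶜ → ℕ, ∏ b = n''}`, `t ↦ (t|_E, t|_{Eᶜ})`,
stated here over Mathlib's `Nat.finMulAntidiag` / `Nat.divisorsAntidiagonal` with `E`, `Eᶜ` enumerated increasingly by
`Finset.orderEmbOfFin` (`sum_finMulAntidiag_split`), and its factorised form (`sum_finMulAntidiag_split_mul`): for a
weight `φ` of `n' = ∏_{e∈E} t_e` and `1`-variable factors `υ_j`,
`∑_{∏ t = n} φ(∏_E t) ∏_j υ_j(t_j) = ∑_{n'n'' = n} φ(n') Y₁(n') Y₂(n'')`.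
Def-free; companion of `…SieveConst01651TypeIICoeffs.lean` (where `Y₁, Y₂` are shown admissible in (II)).
-/

open Finset

namespace Summit.Parity.GeneralizedHardyLittlewood.FordMaynardSieveConst01651SieveConst01651

/-- Reindexing a product over `E ⊆ Fin N` by the increasing enumeration `E.orderEmbOfFin`. [folklore] -/
theorem prod_comp_orderEmbOfFin {N : ℕ} {β : Type*} [CommMonoid β] (E : Finset (Fin N)) {k : ℕ}
    (hk : E.card = k) (f : Fin N → β) : ∏ i : Fin k, f (E.orderEmbOfFin hk i) = ∏ j ∈ E, f j := by
  conv_rhs => rw [← Finset.map_orderEmbOfFin_univ E hk]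
  rw [Finset.prod_map]
  rfl

/-- A product over all coordinates splits into the `E`-part and the `Eᶜ`-part, each reindexed by its increasing
enumeration. [folklore] -/
theorem prod_eq_prod_orderEmbOfFin_mul {N : ℕ} {β : Type*} [CommMonoid β] (E : Finset (Fin N)) {k l : ℕ}
    (hk : E.card = k) (hl : Eᶜ.card = l) (f : Fin N → β) :
    ∏ j, f j = (∏ i : Fin k, f (E.orderEmbOfFin hk i)) * ∏ i : Fin l, f (Eᶜ.orderEmbOfFin hl i) := by
  rw [prod_comp_orderEmbOfFin E hk, prod_comp_orderEmbOfFin Eᶜ hl, Finset.prod_mul_prod_compl]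

/-- **Splitting `N`-tuples with product `n` along `E`** (the bijection behind `Y₁ Y₂` in the proof of
Proposition 7.22): for any `H`,
`∑_{t : ∏ t = n} H(t|_E, t|_{Eᶜ}) = ∑_{(n', n'') : n'n'' = n} ∑_{a : ∏ a = n'} ∑_{b : ∏ b = n''} H(a, b)`,
restrictions enumerated increasingly. [cite: FordMaynard2024PrimeSieves, proof of Proposition 7.22 (Y₁, Y₂ after (eq:sieve-final))] -/
theorem sum_finMulAntidiag_split {N : ℕ} (E : Finset (Fin N)) {k l : ℕ} (hk : E.card = k) (hl : Eᶜ.card = l)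
    {M : Type*} [AddCommMonoid M] (H : (Fin k → ℕ) → (Fin l → ℕ) → M) (n : ℕ) :
    ∑ t ∈ Nat.finMulAntidiag N n, H (fun i => t (E.orderEmbOfFin hk i)) (fun i => t (Eᶜ.orderEmbOfFin hl i)) =
      ∑ p ∈ n.divisorsAntidiagonal, ∑ a ∈ Nat.finMulAntidiag k p.1, ∑ b ∈ Nat.finMulAntidiag l p.2, H a b := by
  classical
  -- the glueing map (inverse of `t ↦ (t|_E, t|_{Eᶜ})`)
  set glue : (Fin k → ℕ) → (Fin l → ℕ) → Fin N → ℕ := fun a b j =>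
    if h : j ∈ E then a ((E.orderIsoOfFin hk).symm ⟨j, h⟩)
    else b ((Eᶜ.orderIsoOfFin hl).symm ⟨j, Finset.mem_compl.mpr h⟩) with hglue
  have hσmem : ∀ i, E.orderEmbOfFin hk i ∈ E := fun i => E.orderEmbOfFin_mem hk i
  have hσ'mem : ∀ i, Eᶜ.orderEmbOfFin hl i ∉ E := fun i => Finset.mem_compl.mp (Eᶜ.orderEmbOfFin_mem hl i)
  have glue_σ : ∀ a b i, glue a b (E.orderEmbOfFin hk i) = a i := by
    intro a b i
    simp only [hglue, dif_pos (hσmem i)]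
    congr 1
    apply (E.orderIsoOfFin hk).symm_apply_eq.mpr
    exact Subtype.ext (E.coe_orderIsoOfFin_apply hk i).symm
  have glue_σ' : ∀ a b i, glue a b (Eᶜ.orderEmbOfFin hl i) = b i := by
    intro a b i
    simp only [hglue, dif_neg (hσ'mem i)]
    congr 1
    apply (Eᶜ.orderIsoOfFin hl).symm_apply_eq.mpr
    exact Subtype.ext (Eᶜ.coe_orderIsoOfFin_apply hl i).symm
  have glue_res : ∀ t : Fin N → ℕ,
      glue (fun i => t (E.orderEmbOfFin hk i)) (fun i => t (Eᶜ.orderEmbOfFin hl i)) = t := by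
    intro t
    funext j
    by_cases h : j ∈ E
    · simp only [hglue, dif_pos h]
      rw [← E.coe_orderIsoOfFin_apply hk, OrderIso.apply_symm_apply]
    · simp only [hglue, dif_neg h]
      rw [← Eᶜ.coe_orderIsoOfFin_apply hl, OrderIso.apply_symm_apply]
  -- right side as one sum over a sigma finset
  rw [show (∑ p ∈ n.divisorsAntidiagonal, ∑ a ∈ Nat.finMulAntidiag k p.1, ∑ b ∈ Nat.finMulAntidiag l p.2, H a b) =
      ∑ x ∈ n.divisorsAntidiagonal.sigma (fun p => Nat.finMulAntidiag k p.1 ×ˢ Nat.finMulAntidiag l p.2),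
        H x.2.1 x.2.2 by
    rw [Finset.sum_sigma]
    refine Finset.sum_congr rfl fun p _ => ?_
    rw [Finset.sum_product]]
  refine Finset.sum_nbij'
    (fun t => ⟨(∏ i : Fin k, t (E.orderEmbOfFin hk i), ∏ i : Fin l, t (Eᶜ.orderEmbOfFin hl i)),
      (fun i => t (E.orderEmbOfFin hk i), fun i => t (Eᶜ.orderEmbOfFin hl i))⟩)
    (fun x => glue x.2.1 x.2.2) ?_ ?_ ?_ ?_ ?_
  · -- maps into the sigma finset
    intro t ht
    obtain ⟨hprod, hn⟩ := Nat.mem_finMulAntidiag.mp ht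
    rw [prod_eq_prod_orderEmbOfFin_mul E hk hl] at hprod
    rw [Finset.mem_sigma, Nat.mem_divisorsAntidiagonal, Finset.mem_product,
      Nat.mem_finMulAntidiag, Nat.mem_finMulAntidiag]
    dsimp only
    have h1 : ∏ i : Fin k, t (E.orderEmbOfFin hk i) ≠ 0 := by
      intro h0; rw [h0, zero_mul] at hprod; exact hn hprod.symm
    have h2 : ∏ i : Fin l, t (Eᶜ.orderEmbOfFin hl i) ≠ 0 := by
      intro h0; rw [h0, mul_zero] at hprod; exact hn hprod.symm
    exact ⟨⟨hprod, hn⟩, ⟨rfl, h1⟩, ⟨rfl, h2⟩⟩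
  · -- glue maps back
    rintro ⟨⟨p₁, p₂⟩, a, b⟩ hx
    rw [Finset.mem_sigma, Nat.mem_divisorsAntidiagonal, Finset.mem_product,
      Nat.mem_finMulAntidiag, Nat.mem_finMulAntidiag] at hx
    obtain ⟨⟨hpn, hn⟩, ⟨ha, _⟩, ⟨hb, _⟩⟩ := hx
    rw [Nat.mem_finMulAntidiag]
    refine ⟨?_, hn⟩
    dsimp only at hpn ha hb ⊢
    rw [prod_eq_prod_orderEmbOfFin_mul E hk hl]
    simp only [glue_σ, glue_σ']
    rw [ha, hb, hpn]
  · -- left inverse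
    intro t _
    exact glue_res t
  · -- right inverse
    rintro ⟨⟨p₁, p₂⟩, a, b⟩ hx
    rw [Finset.mem_sigma, Nat.mem_divisorsAntidiagonal, Finset.mem_product,
      Nat.mem_finMulAntidiag, Nat.mem_finMulAntidiag] at hx
    obtain ⟨⟨_, _⟩, ⟨ha, _⟩, ⟨hb, _⟩⟩ := hx
    dsimp only at ha hb ⊢
    simp only [glue_σ, glue_σ']
    rw [ha, hb]
  · -- summands agree
    intro t _
    rfl

/-- **Factorised form** (display after (eq:sieve-final)): with `Y₁(n') = ∑_{∏ a = n'} ∏ᵢ υ_{σ i}(aᵢ)` over the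
`E`-coordinates and `Y₂(n'')` over the `Eᶜ`-coordinates (`σ`, `σ'` the increasing enumerations), for every weight `φ`
of the `E`-product,
`∑_{∏ t = n} φ(∏_{e∈E} t_e) ∏_j υ_j(t_j) = ∑_{n'n'' = n} φ(n') Y₁(n') Y₂(n'')`.
[cite: FordMaynard2024PrimeSieves, proof of Proposition 7.22 (Y₁, Y₂ after (eq:sieve-final))] -/
theorem sum_finMulAntidiag_split_mul {N : ℕ} (E : Finset (Fin N)) {k l : ℕ} (hk : E.card = k)
    (hl : Eᶜ.card = l) {R : Type*} [CommRing R] (φ : ℕ → R) (υ : Fin N → ℕ → R) (n : ℕ) :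
    ∑ t ∈ Nat.finMulAntidiag N n, φ (∏ i : Fin k, t (E.orderEmbOfFin hk i)) * ∏ j, υ j (t j) =
      ∑ p ∈ n.divisorsAntidiagonal, φ p.1 *
        (∑ a ∈ Nat.finMulAntidiag k p.1, ∏ i, υ (E.orderEmbOfFin hk i) (a i)) *
        (∑ b ∈ Nat.finMulAntidiag l p.2, ∏ i, υ (Eᶜ.orderEmbOfFin hl i) (b i)) := by
  have h := sum_finMulAntidiag_split E hk hl
    (fun a b => φ (∏ i, a i) * (∏ i, υ (E.orderEmbOfFin hk i) (a i)) *
      ∏ i, υ (Eᶜ.orderEmbOfFin hl i) (b i)) n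
  simp only at h
  rw [show (∑ t ∈ Nat.finMulAntidiag N n, φ (∏ i : Fin k, t (E.orderEmbOfFin hk i)) * ∏ j, υ j (t j)) =
      ∑ t ∈ Nat.finMulAntidiag N n, φ (∏ i : Fin k, t (E.orderEmbOfFin hk i)) *
        (∏ i : Fin k, υ (E.orderEmbOfFin hk i) (t (E.orderEmbOfFin hk i))) *
        ∏ i : Fin l, υ (Eᶜ.orderEmbOfFin hl i) (t (Eᶜ.orderEmbOfFin hl i)) by
    refine Finset.sum_congr rfl fun t _ => ?_
    rw [prod_eq_prod_orderEmbOfFin_mul E hk hl (fun j => υ j (t j)), mul_assoc], h]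
  refine Finset.sum_congr rfl fun p _ => ?_
  have inner : ∀ a ∈ Nat.finMulAntidiag k p.1,
      (∑ b ∈ Nat.finMulAntidiag l p.2, φ (∏ i, a i) * (∏ i, υ (E.orderEmbOfFin hk i) (a i)) *
        ∏ i, υ (Eᶜ.orderEmbOfFin hl i) (b i)) =
      (φ p.1 * ∏ i, υ (E.orderEmbOfFin hk i) (a i)) *
        ∑ b ∈ Nat.finMulAntidiag l p.2, ∏ i, υ (Eᶜ.orderEmbOfFin hl i) (b i) := by
    intro a ha
    rw [Nat.prod_eq_of_mem_finMulAntidiag ha, Finset.mul_sum]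
  rw [Finset.sum_congr rfl inner, ← Finset.sum_mul, ← Finset.mul_sum]

end Summit.Parity.GeneralizedHardyLittlewood.FordMaynardSieveConst01651SieveConst01651
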